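import Summits.QuantumFields.YangMills.Theorems.BalabanUVNodesN12ForestSliceOfProxiesB
import Summits.QuantumFields.YangMills.Theorems.BalabanUVNodesN12ForestPreimageL1Letter
import Literature.MathematicalPhysics.QuantumFieldTheory.Balaban1983to89.Node00.MultiScaleFibreChartLocalityComponentB
import HarnessLib

/-!
# BalabanUVNodes ∕ N12 — FOREST-SLICE PREIMAGES WITH AN `ℓ¹` LETTER AND `Γ₀`-SUPPORT **OVER A BOND DATUM `𝔅`** AND AT PRINT's DATUM `lamBondsSeq (maxDomT ν.M₁ Z) k` ([II] (2.3)) WITH THE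
# PRINT-ROOTED FOREST: the (F)-edition of this seat's g14 `…N12ForestPreimageL1Letter` (✓p711784) — input (R1) of the (M)-row chain (`…SlicePreimageLetterOfClass` → `…MultiplierLetterOfClass`)
# at print's datum

[Balaban1984PropagatorsII] = «[II]», (2.3) p. 224; [Balaban1985Variational] = «[15]», (4) p. 278, (16)–(18) p. 280, Sect. C (44)–(48) p. 285, (82)–(83) p. 290; [Balaban1988Convergent] = «[III]»,
(2.2) p. 255, (2.10)–(2.13) pp. 256–257; [Balaban1985Averaging] (11) p. 19, (17)–(19) pp. 20–21; [Balaban1987RG1] (0.4) p. 253.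

Cell `pub-ymgap` (HUMAN RULINGS D-0062 ∕ D-0149), WIDTH SEAT `pub-ymgap-dag-n12-w6` g25 (node N12 = [B15]; key K1⁹ `stmt-QuantumFields-27364`, `--kind proof --supports … --as helper`;
count-neutral).  THEOREMS ONLY (0 `def`, 0 `instance`, 0 `sorry`); the parent's proof texts over a bond datum, BY NAME over: this seat's g14 `…N12ForestProjectionL1Letter.exists_forestProjection_l1`
(root-set-generic, datum-free — used as is) and `…N12ForestPreimageL1Letter.sum_opNorm_le_of_l2Letter`, this seat's `…N12ForestSliceOfProxiesB.fderiv_msChart_orbitTangent_apply_eq_zero_of_sharpProxy`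
(over `𝔅`), dag-n12-d's B-twins `…DirectSurjHsurjProxiesPrelimB` ∕ `…TowerProxiesOfClassB.towerProxies_lamBondsSeq_of_mem_class`, the lane's `Node00/MultiScaleFibreChartLocalityComponentB`
(`fderiv_msChartB_apply_levelZero`), this seat's `…N12HsurjOfClassLam.exists_rightInverse_lamBondsSeq_of_isMinimizerB_class_of_agreeOnB` (the lettered right inverse at print's datum from the
class).  Imports green (no `Record13*`).

CONTENTS (namespace `Summit.QuantumFields.YangMills.BalabanUVNodes.N12ForestPreimageL1LetterB`; parent short names kept, `_Bj ↦ _lamBondsSeq`): §1 ★★ `exists_forest_preimage_l1_of_proxies (𝔅)`;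
§2 ★★ `exists_forest_preimage_l1_of_rightInverse (𝔅)`, `apply_eq_zero_of_preimage_levelZero`, ★★ `exists_forest_preimage_l1_support_of_rightInverse (𝔅)`; §3 ★★★
`exists_forest_preimage_l1_support_lamBondsSeq_of_isMinimizerB_class` (EVERY class minimiser over any bond datum, base-point row `AgreeOnB (lamBondsSeq …) (M˙U₀) W`, print-rooted forest with
(F1) and paths of length `≤ Lp`; per-height letters = p705019's VERBATIM).

HONEST FRAMING.  Bookkeeping by name; per-height EXISTENCE letters (volume-dependent; print's (46) NOT claimed); existence ∕ uniqueness of the print minimiser is a hypothesis (FLAG №16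
untouched); nothing of Bałaban's estimates asserted or refuted; count-neutral helper; N12 NOT discharged; K0⁷∕K1⁹ NOT closed; counts of record unmoved; one finite 𝕋⁴ programme at fixed ε —
R4 closes only the conditional rung `BalabanLadder.UV`; no summit statement is proved here and NOT the Yang–Mills mass gap (Clay); nothing continuum ∕ ℝ⁴ ∕ OS.
-/

noncomputable section

namespace Summit.QuantumFields.YangMills.BalabanUVNodes.N12ForestPreimageL1LetterB

open scoped BigOperators Matrix.Norms.L2Operator Topology
open Literature.MathematicalPhysics.QuantumFieldTheory.Balaban1983to89
open T4Continuum
open B15DeterminingSets B15DeterminingSetsB GaugeField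
open ExpMeanLog (expMeanLogSU)
open T4AdjointCovarianceUnitary (lieSU specialUnitaryAd coe_specialUnitaryAd)
open Node00
open B5Eq118OneStroke (iterBlockOf)
open B14.Eq213DetSet (Bj maxDomT)
open B14.Eq213MaximalDomains (side)
open B14.Eq216Concrete (feeds)
open B15Eq112TorusCover (lift)
open T4AxialGaugeSmallField (boxPlaqs)
open T4CubeChartGnomonic (SU2)
open Summit.QuantumFields.YangMills.BalabanUVNodes.N12ForestSliceOfProxiesB (fderiv_msChart_orbitTangent_apply_eq_zero_of_sharpProxy)
open Summit.QuantumFields.YangMills.BalabanUVNodes.N12DirectSurjHsurjProxiesPrelimB (fderiv_msChart_apply_eq_zero_of_vanish_sharp' differentiableAt_msChart_of_towerProxies)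
open Summit.QuantumFields.YangMills.BalabanUVNodes.N12ForestProjectionL1Letter (exists_forestProjection_l1)
open Summit.QuantumFields.YangMills.BalabanUVNodes.N12ForestPreimageL1Letter (sum_opNorm_le_of_l2Letter)
open Summit.QuantumFields.YangMills.BalabanUVNodes.N12HsurjOfClassLam (exists_rightInverse_lamBondsSeq_of_isMinimizerB_class_of_agreeOnB)
open Summit.QuantumFields.YangMills.BalabanUVNodes.N12TowerProxiesOfClassB (towerProxies_lamBondsSeq_of_mem_class)
open Summit.QuantumFields.YangMills.BalabanUVNodes.N12SiteProxiesOfClass (siteProxies_Bj_of_mem_class)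
open Summit.QuantumFields.YangMills.BalabanUVNodes.N12DirectSurjHsurjPrelim (inner_endpoint_of_mem_bondsOf_Bj)

variable {F : T4Family} {N : ℕ} [NeZero N] {K k : ℕ}

/-- `embIter 0 ∘ iterBlockOf 0 = id`, at a variable level `j = 0` (the parent's two-line lemma, private copy). [folklore] -/
private theorem embIter_iterBlockOf_of_eq_zero {P : Params} {j : ℕ} (h : j = 0) (x : Site P 0) : embIter j (iterBlockOf j x) = x := by
  subst h; rfl

/-! ## §1  Slice-valued companions with the same image and an `ℓ¹(op)` letter — bond datum -/

section Companion

/-- ★★ **SLICE-VALUED COMPANION WITH THE SAME IMAGE AND AN `ℓ¹` LETTER, BOND DATUM** (the parent's §1 over `𝔅 : BDetSet`): datum `W` with `U₀` in its `𝔅`-fibre, `Ψ_{𝔅,W,U₀}` differentiable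
at `0`, one guarded sharp proxy per row of positive level, a rooted forest with (F1) whose roots contain `R(𝔅, k) = {ι_j c± : j ≤ k, c ∈ 𝔅 j}` and whose paths have length `≤ Lp`.  Then every
bond field `X₀` has a companion `X` VANISHING ON EVERY PATH BOND with `DΨ(0) X = DΨ(0) X₀` and `Σ_b‖↑X_b‖_op ≤ (1 + 2·#bonds·Lp)·Σ_b‖↑X₀,b‖_op`.
[cite: Balaban1985Variational, (4) p.278, (16)–(18) p.280, (45)–(48) p.285, (82)–(83) p.290; Balaban1988Convergent, (2.10)–(2.11) p.256; Balaban1984PropagatorsII, (2.3) p.224] -/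
theorem exists_forest_preimage_l1_of_proxies (𝔅 : BDetSet (F.P K)) (hk : k ≤ (F.P K).m + (F.P K).K)
    {W : MSField (F.P K) (SU N)} {U₀ : GaugeField (F.P K) 0 (SU N)} (hU : AgreeOnB 𝔅 (avgFamily (avOfRecord F N K) U₀) W)
    (hΨ : DifferentiableAt ℝ (msChartB F N K k 𝔅 W U₀) 0)
    (hsharp : ∀ i : Fin (constrCardB 𝔅 k), 1 ≤ (((constrEnumB 𝔅 k).symm i).1 : ℕ) → ∃ U' : GaugeField (F.P K) 0 (SU N),
      SmallBelow (avOfRecord F N K) k U' ∧ ∀ b₀ : PBond (F.P K) 0,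
        (iterBlockOf (((constrEnumB 𝔅 k).symm i).1 : ℕ) b₀.src = ((constrEnumB 𝔅 k).symm i).2.1.src ∨
          iterBlockOf (((constrEnumB 𝔅 k).symm i).1 : ℕ) b₀.src = ((constrEnumB 𝔅 k).symm i).2.1.tgt) →
        (iterBlockOf (((constrEnumB 𝔅 k).symm i).1 : ℕ) b₀.tgt = ((constrEnumB 𝔅 k).symm i).2.1.src ∨
          iterBlockOf (((constrEnumB 𝔅 k).symm i).1 : ℕ) b₀.tgt = ((constrEnumB 𝔅 k).symm i).2.1.tgt) → U' b₀ = U₀ b₀)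
    {path : Site (F.P K) 0 → List (LStep (F.P K) 0)}
    (hroot : ∀ r ∈ {z : Site (F.P K) 0 | ∃ j, j ≤ k ∧ ∃ c ∈ 𝔅 j, (z = embIter j c.src ∨ z = embIter j c.tgt)}, path r = [])
    (hF1 : ∀ x, ∀ s ∈ path x, ∃ x' x'' : Site (F.P K) 0, path x'' = path x' ++ [s] ∧
      (s.fwd = true → s.bond.src = x' ∧ s.bond.tgt = x'') ∧ (s.fwd = false → s.bond.src = x'' ∧ s.bond.tgt = x'))
    {Lp : ℕ} (hlen : ∀ x, (path x).length ≤ Lp) (X₀ : PBond (F.P K) 0 → lieSU (Fin N)) :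
    ∃ X : PBond (F.P K) 0 → lieSU (Fin N), (∀ x, ∀ s ∈ path x, X s.bond = 0) ∧
      fderiv ℝ (msChartB F N K k 𝔅 W U₀) 0 X = fderiv ℝ (msChartB F N K k 𝔅 W U₀) 0 X₀ ∧
      ∑ b, ‖(X b : Matrix (Fin N) (Fin N) ℂ)‖ ≤ (1 + 2 * (Fintype.card (PBond (F.P K) 0)) * Lp) * ∑ b, ‖(X₀ b : Matrix (Fin N) (Fin N) ℂ)‖ := by
  obtain ⟨ξ, hξR, hvan, -, hl1⟩ := exists_forestProjection_l1 U₀ hroot hF1 hlen X₀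
  -- the orbit tangent of `ξ` lies in `ker DΨ_{U₀}(0)`
  have hT : fderiv ℝ (msChartB F N K k 𝔅 W U₀) 0 (fun b => specialUnitaryAd (U₀ b)⁻¹ (ξ b.src) - ξ b.tgt) = 0 := by
    funext i
    rw [Pi.zero_apply]
    have hj : (((constrEnumB 𝔅 k).symm i).1 : ℕ) ≤ k := Nat.le_of_lt_succ ((constrEnumB 𝔅 k).symm i).1.isLt
    have hc : ((constrEnumB 𝔅 k).symm i).2.1 ∈ 𝔅 ((constrEnumB 𝔅 k).symm i).1 := ((constrEnumB 𝔅 k).symm i).2.2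
    have hsrc : ξ (embIter ((constrEnumB 𝔅 k).symm i).1 ((constrEnumB 𝔅 k).symm i).2.1.src) = 0 := hξR _ ⟨_, hj, _, hc, Or.inl rfl⟩
    have htgt : ξ (embIter ((constrEnumB 𝔅 k).symm i).1 ((constrEnumB 𝔅 k).symm i).2.1.tgt) = 0 := hξR _ ⟨_, hj, _, hc, Or.inr rfl⟩
    rcases Nat.eq_zero_or_pos (((constrEnumB 𝔅 k).symm i).1 : ℕ) with h0 | hpos
    · refine fderiv_msChart_apply_eq_zero_of_vanish_sharp' hk hΨ _ i fun b₀ hs ht => ?_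
      have hs' : ξ b₀.src = 0 := by
        rw [← embIter_iterBlockOf_of_eq_zero h0 b₀.src]
        rcases hs with h | h
        · rw [h]; exact hsrc
        · rw [h]; exact htgt
      have ht' : ξ b₀.tgt = 0 := by
        rw [← embIter_iterBlockOf_of_eq_zero h0 b₀.tgt]
        rcases ht with h | h
        · rw [h]; exact hsrc
        · rw [h]; exact htgt
      simp only [hs', ht', map_zero, sub_zero]
    · obtain ⟨U', hsb', hin⟩ := hsharp i hpos
      exact fderiv_msChart_orbitTangent_apply_eq_zero_of_sharpProxy hk hU hΨ hsb' i hin ξ hsrc htgt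
  refine ⟨fun b => X₀ b - (specialUnitaryAd (U₀ b)⁻¹ (ξ b.src) - ξ b.tgt), hvan, ?_, hl1⟩
  have hsub : (fun b => X₀ b - (specialUnitaryAd (U₀ b)⁻¹ (ξ b.src) - ξ b.tgt)) =
      X₀ - fun b => specialUnitaryAd (U₀ b)⁻¹ (ξ b.src) - ξ b.tgt := rfl
  rw [hsub, map_sub, hT, sub_zero]

end Companion

/-! ## §2  With a lettered right inverse: slice preimages with an `ℓ¹` letter and their level-`0` support — bond datum -/

section Lettered

/-- ★★ **SLICE PREIMAGES WITH AN `ℓ¹` LETTER FROM A LETTERED RIGHT INVERSE, BOND DATUM**: under the hypotheses of §1, a right inverse `H` of `DΨ_{𝔅,W,U₀}(0)` with the `ℓ²(HS)` letter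
`√(Σ_b‖H v b‖²) ≤ B‖v‖` (this lineage's (P4)′ shape at print's datum: `…HsurjProxiesLam` ∕ `…HsurjOfClassLam`) gives every datum `τ` a preimage `X` vanishing on every path bond with
`Σ_b‖↑X_b‖_op ≤ ((1 + 2·#bonds·Lp)·√#bonds·B)·‖τ‖`. [cite: Balaban1985Variational, Sect. C (45)–(46) p.285, (82)–(83) p.290; Balaban1988Convergent, (2.10)–(2.11) p.256; Balaban1984PropagatorsII, (2.3) p.224] -/
theorem exists_forest_preimage_l1_of_rightInverse (𝔅 : BDetSet (F.P K)) (hk : k ≤ (F.P K).m + (F.P K).K)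
    {W : MSField (F.P K) (SU N)} {U₀ : GaugeField (F.P K) 0 (SU N)} (hU : AgreeOnB 𝔅 (avgFamily (avOfRecord F N K) U₀) W)
    (hΨ : DifferentiableAt ℝ (msChartB F N K k 𝔅 W U₀) 0)
    (hsharp : ∀ i : Fin (constrCardB 𝔅 k), 1 ≤ (((constrEnumB 𝔅 k).symm i).1 : ℕ) → ∃ U' : GaugeField (F.P K) 0 (SU N),
      SmallBelow (avOfRecord F N K) k U' ∧ ∀ b₀ : PBond (F.P K) 0,
        (iterBlockOf (((constrEnumB 𝔅 k).symm i).1 : ℕ) b₀.src = ((constrEnumB 𝔅 k).symm i).2.1.src ∨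
          iterBlockOf (((constrEnumB 𝔅 k).symm i).1 : ℕ) b₀.src = ((constrEnumB 𝔅 k).symm i).2.1.tgt) →
        (iterBlockOf (((constrEnumB 𝔅 k).symm i).1 : ℕ) b₀.tgt = ((constrEnumB 𝔅 k).symm i).2.1.src ∨
          iterBlockOf (((constrEnumB 𝔅 k).symm i).1 : ℕ) b₀.tgt = ((constrEnumB 𝔅 k).symm i).2.1.tgt) → U' b₀ = U₀ b₀)
    {path : Site (F.P K) 0 → List (LStep (F.P K) 0)}
    (hroot : ∀ r ∈ {z : Site (F.P K) 0 | ∃ j, j ≤ k ∧ ∃ c ∈ 𝔅 j, (z = embIter j c.src ∨ z = embIter j c.tgt)}, path r = [])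
    (hF1 : ∀ x, ∀ s ∈ path x, ∃ x' x'' : Site (F.P K) 0, path x'' = path x' ++ [s] ∧
      (s.fwd = true → s.bond.src = x' ∧ s.bond.tgt = x'') ∧ (s.fwd = false → s.bond.src = x'' ∧ s.bond.tgt = x'))
    {Lp : ℕ} (hlen : ∀ x, (path x).length ≤ Lp)
    (H : (Fin (constrCardB 𝔅 k) → lieSU (Fin N)) → PBond (F.P K) 0 → lieSU (Fin N)) {B : ℝ}
    (hHinv : ∀ v, fderiv ℝ (msChartB F N K k 𝔅 W U₀) 0 (H v) = v) (hHB : ∀ v, Real.sqrt (∑ b, ‖H v b‖ ^ 2) ≤ B * ‖v‖)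
    (τ : Fin (constrCardB 𝔅 k) → lieSU (Fin N)) :
    ∃ X : PBond (F.P K) 0 → lieSU (Fin N), (∀ x, ∀ s ∈ path x, X s.bond = 0) ∧ fderiv ℝ (msChartB F N K k 𝔅 W U₀) 0 X = τ ∧
      ∑ b, ‖(X b : Matrix (Fin N) (Fin N) ℂ)‖ ≤ ((1 + 2 * (Fintype.card (PBond (F.P K) 0)) * Lp) * Real.sqrt (Fintype.card (PBond (F.P K) 0)) * B) * ‖τ‖ := by
  obtain ⟨X, hXS, hXim, hXl1⟩ := exists_forest_preimage_l1_of_proxies 𝔅 hk hU hΨ hsharp hroot hF1 hlen (H τ)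
  refine ⟨X, hXS, by rw [hXim, hHinv], hXl1.trans ?_⟩
  have h1 := sum_opNorm_le_of_l2Letter (N := N) (H τ) (hHB τ)
  have hc : 0 ≤ (1 + 2 * (Fintype.card (PBond (F.P K) 0) : ℝ) * Lp) := by positivity
  calc (1 + 2 * (Fintype.card (PBond (F.P K) 0) : ℝ) * Lp) * ∑ b, ‖(H τ b : Matrix (Fin N) (Fin N) ℂ)‖
      ≤ (1 + 2 * (Fintype.card (PBond (F.P K) 0) : ℝ) * Lp) * (Real.sqrt (Fintype.card (PBond (F.P K) 0)) * (B * ‖τ‖)) := mul_le_mul_of_nonneg_left h1 hc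
    _ = ((1 + 2 * (Fintype.card (PBond (F.P K) 0)) * Lp) * Real.sqrt (Fintype.card (PBond (F.P K) 0)) * B) * ‖τ‖ := by ring

/-- **A PREIMAGE OF A DATUM NOT CHARGING THE LEVEL-`0` ROW OF `c` VANISHES AT `c`** (`c ∈ 𝔅 0`): the `Γ₀` layer of `DΨ_{U₀}(0)` is the evaluation (`Node00.fderiv_msChartB_apply_levelZero`, [III]
(2.11) `M⁰ = id`). [cite: Balaban1988Convergent, (2.2) p.255, (2.11) p.256; Balaban1985Variational, (82)–(83) p.290] -/
theorem apply_eq_zero_of_preimage_levelZero {𝔅 : BDetSet (F.P K)} {W : MSField (F.P K) (SU N)} {U₀ : GaugeField (F.P K) 0 (SU N)}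
    (hU : AgreeOnB 𝔅 (avgFamily (avOfRecord F N K) U₀) W) (hΨ : DifferentiableAt ℝ (msChartB F N K k 𝔅 W U₀) 0)
    {X : PBond (F.P K) 0 → lieSU (Fin N)} {τ : Fin (constrCardB 𝔅 k) → lieSU (Fin N)} (hX : fderiv ℝ (msChartB F N K k 𝔅 W U₀) 0 X = τ)
    (c : PBond (F.P K) 0) (hc : c ∈ 𝔅 0) (hτ : τ (constrEnumB 𝔅 k ⟨⟨0, Nat.succ_pos k⟩, c, hc⟩) = 0) : X c = 0 := by
  rw [← fderiv_msChartB_apply_levelZero hU hΨ c hc X, hX, hτ]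

/-- ★★ **SLICE PREIMAGES WITH `ℓ¹` LETTER AND LEVEL-`0` SUPPORT, BOND DATUM**: as `exists_forest_preimage_l1_of_rightInverse`, and in addition `X c = 0` at every `c ∈ 𝔅 0` whose level-`0`
row the datum `τ` does not charge. [cite: Balaban1985Variational, Sect. C (45)–(46) p.285, (82)–(83) p.290; Balaban1988Convergent, (2.2) p.255, (2.10)–(2.11) p.256; Balaban1984PropagatorsII, (2.3) p.224] -/
theorem exists_forest_preimage_l1_support_of_rightInverse (𝔅 : BDetSet (F.P K)) (hk : k ≤ (F.P K).m + (F.P K).K)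
    {W : MSField (F.P K) (SU N)} {U₀ : GaugeField (F.P K) 0 (SU N)} (hU : AgreeOnB 𝔅 (avgFamily (avOfRecord F N K) U₀) W)
    (hΨ : DifferentiableAt ℝ (msChartB F N K k 𝔅 W U₀) 0)
    (hsharp : ∀ i : Fin (constrCardB 𝔅 k), 1 ≤ (((constrEnumB 𝔅 k).symm i).1 : ℕ) → ∃ U' : GaugeField (F.P K) 0 (SU N),
      SmallBelow (avOfRecord F N K) k U' ∧ ∀ b₀ : PBond (F.P K) 0,
        (iterBlockOf (((constrEnumB 𝔅 k).symm i).1 : ℕ) b₀.src = ((constrEnumB 𝔅 k).symm i).2.1.src ∨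
          iterBlockOf (((constrEnumB 𝔅 k).symm i).1 : ℕ) b₀.src = ((constrEnumB 𝔅 k).symm i).2.1.tgt) →
        (iterBlockOf (((constrEnumB 𝔅 k).symm i).1 : ℕ) b₀.tgt = ((constrEnumB 𝔅 k).symm i).2.1.src ∨
          iterBlockOf (((constrEnumB 𝔅 k).symm i).1 : ℕ) b₀.tgt = ((constrEnumB 𝔅 k).symm i).2.1.tgt) → U' b₀ = U₀ b₀)
    {path : Site (F.P K) 0 → List (LStep (F.P K) 0)}
    (hroot : ∀ r ∈ {z : Site (F.P K) 0 | ∃ j, j ≤ k ∧ ∃ c ∈ 𝔅 j, (z = embIter j c.src ∨ z = embIter j c.tgt)}, path r = [])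
    (hF1 : ∀ x, ∀ s ∈ path x, ∃ x' x'' : Site (F.P K) 0, path x'' = path x' ++ [s] ∧
      (s.fwd = true → s.bond.src = x' ∧ s.bond.tgt = x'') ∧ (s.fwd = false → s.bond.src = x'' ∧ s.bond.tgt = x'))
    {Lp : ℕ} (hlen : ∀ x, (path x).length ≤ Lp)
    (H : (Fin (constrCardB 𝔅 k) → lieSU (Fin N)) → PBond (F.P K) 0 → lieSU (Fin N)) {B : ℝ}
    (hHinv : ∀ v, fderiv ℝ (msChartB F N K k 𝔅 W U₀) 0 (H v) = v) (hHB : ∀ v, Real.sqrt (∑ b, ‖H v b‖ ^ 2) ≤ B * ‖v‖)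
    (τ : Fin (constrCardB 𝔅 k) → lieSU (Fin N)) :
    ∃ X : PBond (F.P K) 0 → lieSU (Fin N), (∀ x, ∀ s ∈ path x, X s.bond = 0) ∧ fderiv ℝ (msChartB F N K k 𝔅 W U₀) 0 X = τ ∧
      ∑ b, ‖(X b : Matrix (Fin N) (Fin N) ℂ)‖ ≤ ((1 + 2 * (Fintype.card (PBond (F.P K) 0)) * Lp) * Real.sqrt (Fintype.card (PBond (F.P K) 0)) * B) * ‖τ‖ ∧
      ∀ (c : PBond (F.P K) 0) (hc : c ∈ 𝔅 0), τ (constrEnumB 𝔅 k ⟨⟨0, Nat.succ_pos k⟩, c, hc⟩) = 0 → X c = 0 := by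
  obtain ⟨X, hXS, hXim, hXl1⟩ := exists_forest_preimage_l1_of_rightInverse 𝔅 hk hU hΨ hsharp hroot hF1 hlen H hHinv hHB τ
  exact ⟨X, hXS, hXim, hXl1, fun c hc hτ => apply_eq_zero_of_preimage_levelZero hU hΨ hXim c hc hτ⟩

end Lettered

/-! ## §3  At print's datum of record: every class minimiser over any bond datum, proxies and right inverse read off the class -/

section Record

/-- ★★★ **SLICE PREIMAGES WITH `ℓ¹` LETTER AND `Γ₀`-SUPPORT AT PRINT's DATUM FOR EVERY CLASS MINIMISER** — at `lamBondsSeq (maxDomT ν.M₁ Z) k`, a class minimiser `U₀`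
(`IsMinimizerB … 𝔅' W' U₀` over ANY bond datum; only membership and minimiser-hood are read: dag-n12-d's `towerProxies_lamBondsSeq_of_mem_class`, §3b `siteProxies_Bj_of_mem_class`, this seat's
`…HsurjOfClassLam.exists_rightInverse_lamBondsSeq_of_isMinimizerB_class_of_agreeOnB`), any datum `W` with `AgreeOnB (lamBondsSeq …) (M˙U₀) W`, a rooted forest with (F1) at PRINT's tower sites
and paths of length `≤ Lp`: every datum `τ` on print's rows has a preimage `X` under `D(msChartB … (lamBondsSeq …) W U₀)(0)` VANISHING ON EVERY PATH BOND, with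
`Σ_b‖↑X_b‖_op ≤ ((1 + 2·#bonds·Lp)·√#bonds·B)·‖τ‖`, and `X b = 0` at every print `Γ₀`-bond `b ∈ lamBondsSeq (maxDomT ν.M₁ Z) k 0` whose row `τ` does not charge.  Per-HEIGHT letters only:
`hHB` (p678596's ∀-body — the (b)-socket, unchanged), `hsbU`, the floors, `Lp`. [cite: Balaban1984PropagatorsII, (2.3) p.224; Balaban1985Variational, Sect. C (44)–(48) p.285, (82)–(83) p.290; Balaban1988Convergent, (2.2) p.255, (2.10)–(2.13) pp.256–257; Balaban1987RG1, (0.4) p.253] -/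
theorem exists_forest_preimage_l1_support_lamBondsSeq_of_isMinimizerB_class (ν : Node00.Stage7Numerics) (Kt : ℕ) (Z : Set (Site (F.P Kt) 0))
    (hkK : k + 1 ≤ (F.P Kt).m + (F.P Kt).K) (hM4 : 4 * (F.P Kt).L ≤ ν.M₁) (hdiv : side (F.P Kt).L ν.M₁ k ∣ (F.P Kt).sitesPerDir 0) (hε : 0 ≤ ν.εreg)
    {ρ'' : ℝ} (hsbU : ∀ V : GaugeField (F.P Kt) 0 SU2, ‖coeField V - 1‖ ≤ ρ'' → SmallBelow (avOfRecord F 2 Kt) k V)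
    (hερ : 6 * ((((F.P Kt).d - 1 : ℕ)) : ℝ) * (F.P Kt).L * ν.εreg ≤ ρ'')
    {εH B : ℝ}
    (hHB : ∀ (Wd : MSField (F.P Kt) SU2) (U₀ : GaugeField (F.P Kt) 0 SU2),
      AgreeOn (Bj ν.M₁ Z k) (avgFamily (avOfRecord F 2 Kt) U₀) Wd →
      (∀ i' : Fin (constrCard (Bj ν.M₁ Z k) k), ∃ U' : GaugeField (F.P Kt) 0 SU2,
        (∀ b ∈ feeds (((constrEnum (Bj ν.M₁ Z k) k).symm i').1 : ℕ) ((constrEnum (Bj ν.M₁ Z k) k).symm i').2.1, U' b = U₀ b) ∧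
          SmallBelow (avOfRecord F 2 Kt) k U') →
      (∀ (j : ℕ), 1 ≤ j → j ≤ k → ∀ y : Site (F.P Kt) j, embIter j y ∈ maxDomT ν.M₁ Z j → ∃ U' : GaugeField (F.P Kt) 0 SU2,
        (∀ c : PBond (F.P Kt) j, (c.src = y ∨ c.tgt = y) → ∀ b₀ : PBond (F.P Kt) 0,
          (iterBlockOf j b₀.src = c.src ∨ iterBlockOf j b₀.src = c.tgt) → (iterBlockOf j b₀.tgt = c.src ∨ iterBlockOf j b₀.tgt = c.tgt) → U' b₀ = U₀ b₀) ∧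
        SmallBelow (avOfRecord F 2 Kt) k U') →
      (∀ (j : ℕ), 1 ≤ j → j ≤ k → ∀ y : Site (F.P Kt) j, embIter j y ∈ maxDomT ν.M₁ Z j →
        PlaqSmallOn (boxPlaqs (fun κ => lift (F.P Kt) (embIter j y) κ - ((((F.P Kt).L ^ j : ℕ) : ℤ) + ((((F.P Kt).L ^ j - 1) / 2 : ℕ) : ℤ)))
          (fun κ => lift (F.P Kt) (embIter j y) κ + ((((F.P Kt).L ^ j : ℕ) : ℤ) + ((((F.P Kt).L ^ j - 1) / 2 : ℕ) : ℤ))) : Set (Plaq (F.P Kt) 0)) εH U₀) →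
      ∃ H : (Fin (constrCard (Bj ν.M₁ Z k) k) → lieSU (Fin 2)) → PBond (F.P Kt) 0 → lieSU (Fin 2),
        (∀ v, fderiv ℝ (msChart F 2 Kt k (Bj ν.M₁ Z k) Wd U₀) 0 (H v) = v) ∧ ∀ v, Real.sqrt (∑ b, ‖H v b‖ ^ 2) ≤ B * ‖v‖)
    (hεH : ν.εreg ≤ εH)
    -- the minimiser over ANY bond datum (class membership and minimiser-hood only) and the datum on print's fibre
    {𝔅' : BDetSet (F.P Kt)} {W' : MSField (F.P Kt) SU2} {U₀ : GaugeField (F.P Kt) 0 SU2}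
    (hmin : IsMinimizerB (avOfRecord F 2 Kt) (regMSCoPOfRecord F 2 ν Kt k (maxDomT ν.M₁ Z)) 𝔅' W' U₀)
    {W : MSField (F.P Kt) SU2} (hW : AgreeOnB (lamBondsSeq (maxDomT ν.M₁ Z) k) (avgFamily (avOfRecord F 2 Kt) U₀) W)
    -- the print-rooted forest
    {path : Site (F.P Kt) 0 → List (LStep (F.P Kt) 0)}
    (hroot : ∀ r ∈ {z : Site (F.P Kt) 0 | ∃ j, j ≤ k ∧ ∃ c ∈ lamBondsSeq (maxDomT ν.M₁ Z) k j, (z = embIter j c.src ∨ z = embIter j c.tgt)}, path r = [])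
    (hF1 : ∀ x, ∀ s ∈ path x, ∃ x' x'' : Site (F.P Kt) 0, path x'' = path x' ++ [s] ∧
      (s.fwd = true → s.bond.src = x' ∧ s.bond.tgt = x'') ∧ (s.fwd = false → s.bond.src = x'' ∧ s.bond.tgt = x'))
    {Lp : ℕ} (hlen : ∀ x, (path x).length ≤ Lp)
    (τ : Fin (constrCardB (lamBondsSeq (maxDomT ν.M₁ Z) k) k) → lieSU (Fin 2)) :
    ∃ X : PBond (F.P Kt) 0 → lieSU (Fin 2), (∀ x, ∀ s ∈ path x, X s.bond = 0) ∧ fderiv ℝ (msChartB F 2 Kt k (lamBondsSeq (maxDomT ν.M₁ Z) k) W U₀) 0 X = τ ∧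
      ∑ b, ‖(X b : Matrix (Fin 2) (Fin 2) ℂ)‖ ≤ ((1 + 2 * (Fintype.card (PBond (F.P Kt) 0)) * Lp) * Real.sqrt (Fintype.card (PBond (F.P Kt) 0)) * B) * ‖τ‖ ∧
      ∀ (b : PBond (F.P Kt) 0) (hb : b ∈ lamBondsSeq (maxDomT ν.M₁ Z) k 0),
        τ (constrEnumB (lamBondsSeq (maxDomT ν.M₁ Z) k) k ⟨⟨0, Nat.succ_pos k⟩, b, hb⟩) = 0 → X b = 0 := by
  have hk : k ≤ (F.P Kt).m + (F.P Kt).K := by omega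
  -- the class supplies the proxies and the lettered right inverse
  have hprox := towerProxies_lamBondsSeq_of_mem_class ν Kt Z hkK hM4 hdiv hε hsbU hερ hmin.mem_reg
  have hproxSite := siteProxies_Bj_of_mem_class ν Kt Z hkK hM4 hdiv hε hsbU hερ hmin.mem_reg
  obtain ⟨H, hHinv, hHB'⟩ := exists_rightInverse_lamBondsSeq_of_isMinimizerB_class_of_agreeOnB ν Kt Z hkK hM4 hdiv hε hsbU hερ hHB hεH hmin hW
  have hΨ : DifferentiableAt ℝ (msChartB F 2 Kt k (lamBondsSeq (maxDomT ν.M₁ Z) k) W U₀) 0 := differentiableAt_msChart_of_towerProxies hk hW hprox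
  -- sharp proxies for the print rows of positive level, from the site proxies at the row's inner end-point
  have hsharp : ∀ i : Fin (constrCardB (lamBondsSeq (maxDomT ν.M₁ Z) k) k), 1 ≤ (((constrEnumB (lamBondsSeq (maxDomT ν.M₁ Z) k) k).symm i).1 : ℕ) →
      ∃ U' : GaugeField (F.P Kt) 0 SU2, SmallBelow (avOfRecord F 2 Kt) k U' ∧ ∀ b₀ : PBond (F.P Kt) 0,
        (iterBlockOf (((constrEnumB (lamBondsSeq (maxDomT ν.M₁ Z) k) k).symm i).1 : ℕ) b₀.src = ((constrEnumB (lamBondsSeq (maxDomT ν.M₁ Z) k) k).symm i).2.1.src ∨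
          iterBlockOf (((constrEnumB (lamBondsSeq (maxDomT ν.M₁ Z) k) k).symm i).1 : ℕ) b₀.src = ((constrEnumB (lamBondsSeq (maxDomT ν.M₁ Z) k) k).symm i).2.1.tgt) →
        (iterBlockOf (((constrEnumB (lamBondsSeq (maxDomT ν.M₁ Z) k) k).symm i).1 : ℕ) b₀.tgt = ((constrEnumB (lamBondsSeq (maxDomT ν.M₁ Z) k) k).symm i).2.1.src ∨
          iterBlockOf (((constrEnumB (lamBondsSeq (maxDomT ν.M₁ Z) k) k).symm i).1 : ℕ) b₀.tgt = ((constrEnumB (lamBondsSeq (maxDomT ν.M₁ Z) k) k).symm i).2.1.tgt) →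
          U' b₀ = U₀ b₀ := by
    intro i hpos
    have hjk : (((constrEnumB (lamBondsSeq (maxDomT ν.M₁ Z) k) k).symm i).1 : ℕ) ≤ k :=
      Nat.le_of_lt_succ ((constrEnumB (lamBondsSeq (maxDomT ν.M₁ Z) k) k).symm i).1.isLt
    have hc : ((constrEnumB (lamBondsSeq (maxDomT ν.M₁ Z) k) k).symm i).2.1 ∈
        bondsOf ((Bj ν.M₁ Z k : DetSet (F.P Kt)) ((constrEnumB (lamBondsSeq (maxDomT ν.M₁ Z) k) k).symm i).1) :=
      lamBondsSeq_subset_bondsOf_genSet _ _ _ ((constrEnumB (lamBondsSeq (maxDomT ν.M₁ Z) k) k).symm i).2.2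
    rcases inner_endpoint_of_mem_bondsOf_Bj hpos hjk hc with hy | hy
    · obtain ⟨U', hag, hsb'⟩ := hproxSite _ hpos hjk _ hy
      exact ⟨U', hsb', hag _ (Or.inl rfl)⟩
    · obtain ⟨U', hag, hsb'⟩ := hproxSite _ hpos hjk _ hy
      exact ⟨U', hsb', hag _ (Or.inr rfl)⟩
  obtain ⟨X, hXS, hXim, hXl1, hX0⟩ := exists_forest_preimage_l1_support_of_rightInverse (lamBondsSeq (maxDomT ν.M₁ Z) k) hk hW hΨ hsharp hroot hF1 hlen H hHinv hHB' τ
  exact ⟨X, hXS, hXim, hXl1, hX0⟩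

end Record

end Summit.QuantumFields.YangMills.BalabanUVNodes.N12ForestPreimageL1LetterB

end
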